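import Literature.MathematicalPhysics.QuantumFieldTheory.Balaban1983to89.B5Eq114Gauss

/-!
# `Balaban1983to89.B5Eq115GaugeChain` — T. Bałaban, *Propagators and renormalization transformations for lattice
# gauge theories. I*, Commun. Math. Phys. **95** (1984) 17–40 [Balaban1984PropagatorsI]: (1.15) p. 19 — the chain of
# integral identities «Z^{(0)}exp(−½⟨B^{λ₁}, Δ₁B^{λ₁}⟩) = … = Z^{(0)}exp(−½⟨B, Δ₁B⟩)», i.e. the gauge invariance of the
# form ⟨B, Δ₁B⟩ for the operator Δ₁ DEFINED by the Gaussian integral (1.14) — PROVED AS PRINTED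

statement-level skeleton of published theorems with citation tags; proofs where landed; nothing here is a claim about the Yang–Mills mass gap

PDF held: `paper:balaban1984-cmp95-propagators-rt-i` (journal page = PDF page + 16); pp. 19–20 [PDF 3–4] read AS IMAGES
(renders `run/shared/lean/pub/pub-balaban/b2b-balaban-ref1/pages/1984-cmp95-propagators-rt-I/…-p003-x2.png`, `…-p004-x2.png`).

CITATION HEADER (lean-in-tree rule).  Cell `lit-balaban` (HOME `run/shared/lean/pub/lit-balaban/`), Phase-2 proof seat
`lit-balaban-p21` gen 3; WHAT IS REPRODUCED = SKELETON row **`B5.Eq1.15`** of `HOME/lit-balaban-r02/ROWS-B5.md` (owner r02;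
SKELETON v3.20 `typed p239699`, HONEST SCOPE there: *"the printed chain of integral identities (Δ₁ defined by (1.14)) is
not reproduced"* — `B5SectAStatements.eq115_formDk` is the invariance of the momentum REPRESENTATION (1.66)).  Proved here
on the carrier of (1.12)/(1.14): r02's real torus fields (`B5SectBStatements`: `Fld/Scl`, the δ-integral `deltaInt` read by
(1.40), `rtT`/`rt12` = (1.12), `Ax` = (1.10), `Qlin`/`QsLin` = (1.11)/(1.13)) and r02's COMPUTED (1.14) `B5Eq114Gauss.
rt12_gauss : (Te^{−S})(B) = Z^{(0)}·exp(−½⟨B, Δ₁B⟩)` (explicit `Z0`, `Delta1 = W†W`); both imported unchanged.  (Seat p16's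
V1-calculus covariance of (1.12), `B5Eq112RenormTransf.renormTransf_gaugeShift` p244077, is not in the tree and not restated.)

WHAT IS PRINTED (p. 19 [PDF 3], verbatim).  «B^λ_c = B_c − L^{−1}(λ(c₊) − λ(c₋)) = B_c − (∂λ)(c), (1.9)»; «B^λ_c = B_c −
L^{−1}((Q′λ)(c₊) − (Q′λ)(c₋)) = B_c − (∂Q′λ)(c). (1.13)»; «(Te^{−S})(B) = Z^{(0)} exp(−½⟨B, Δ₁B⟩) … (1.14)  The form
⟨B, Δ₁B⟩ is gauge invariant. If λ₁ is a gauge transformation on T_L^{(1)}, then defining λ on T₁ as constant on each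
block, λ(x) = λ₁(y) for x∈B(y), we have  Z^{(0)}exp(−½⟨B^{λ₁}, Δ₁B^{λ₁}⟩) = ∫dA δ(B^{λ₁} − QA^λ)δ_Ax(A^λ) exp(−S(A^λ))
= ∫dA δ(B − ∂λ₁ − QA + ∂Q′λ)δ_Ax(A) exp(−S(A)) = Z^{(0)}exp(−½⟨B, Δ₁B⟩). (1.15)»; p. 20 [PDF 4]: «we have Q_kA^λ =
Q_kA − ∂Q′_kλ. The δ-function δ(B − Q_kA) is invariant with respect to gauge transformations λ satisfying Q′_kλ = 0».

WHAT THIS FILE PROVES (0 sorry, 0 new `def … : Prop`, axioms ⊆ {propext, Classical.choice, Quot.sound}).  Three small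
definitions with bodies: `gradR λ` = «(∂λ)» at unit lattice factor (`cplx_gradR`: = the tree's `B5Action121.GradOp N 1`;
«A^λ = A − ∂λ» is written `A − gradR λ`, `cplx_sub_gradR`: = `gaugeT (fine n M) 1`), `blockConst λ₁` = «λ on T₁ constant on
each block», `gaugeC B λ₁ = B^{λ₁}` of (1.9) (`cplx_gaugeC`: = `gaugeT M L⁻¹`).  The printed reasons as kernel theorems:
§1 translation invariance of the δ-integral, `∫dA δ(B + Cv − CA)δ_G(A)ρ(A − v) = ∫dA δ(B − CA)δ_G(A)ρ(A)`, `v ∈ G`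
(`deltaInt_translate`); §2 «S(A^λ) = S(A)» (`action1_sub_gradR` ← `B5Action121.actionS_gaugeT`), (1.13) on real fields
«QA^λ = QA − ∂Q′λ», ∂ = L⁻¹·gradR on `T_L^{(1)}` (`Qlin_gradR`, `Qlin_sub_gradR`: real-field reading of the row-`B5.Eq1.13`
decl `B5Block118.QvOp_gaugeT`, by the printed telescoping), «Q′λ = λ₁» (`QsLin_blockConst`), «δ_Ax(A^λ) = δ_Ax(A)» — every
bond of a contour Γ_{y,x} of (1.7) has both end-points in B(y), where λ is constant (`axSum_gradR_blockConst`,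
`gradR_blockConst_mem_Ax`, `sub_gradR_blockConst_mem_Ax_iff`), the p. 20 sentence at one level
(`Qlin_sub_gradR_of_QsLin_eq_zero`); §3 **(1.15)**: its three equalities (`eq115_member1/2/3`), their conjunction
`eq115_chain` (with the `Z^{(0)}`, `Δ₁` of `B5Eq114Gauss`), the gauge covariance of (1.12) for every density invariant under
block-constant gauge transformations (`rtT_gaugeC`), **`rt12_gaugeC : (Te^{−S})(B^{λ₁}) = (Te^{−S})(B)`** (no hypothesis),
the printed conclusion **`eq115_Delta1 : ⟨B^{λ₁}, Δ₁B^{λ₁}⟩ = ⟨B, Δ₁B⟩`** for `Δ₁ = B5Eq114Gauss.Delta1` (d ≥ 2 via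
`B5Eq114Gauss.Z0_pos`), and its operator form `Delta1_gradR : Δ₁(∂λ₁) = 0`, `Delta1_gaugeC : Δ₁B^{λ₁} = Δ₁B`.

HONEST SCOPE.  (i) Fine lattice = the unit lattice `T₁` with `n·M_μ` sites (blocks of side `n`, the print's `L`), block
lattice `T_L^{(1)}` with `M_μ` sites; every `n ≥ 1`, every torus; U = 1 (the paper's Sect. 1).  (ii) `eq115_Delta1`,
`Delta1_gradR`, `Delta1_gaugeC` carry `2 ≤ d` exactly as r02's `Z0_pos`/`eq114_holds` (were `Z^{(0)} = 0`, both extreme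
members of (1.15) would vanish whatever the form); the integral identities carry no hypothesis.  (iii) The normalisation
of «∫dA δ(…)» is r02's ((1.40)); (1.15) is insensitive to it.  (iv) READING of the member «∫dA δ(B^{λ₁} − QA^λ)δ_Ax(A^λ)
exp(−S(A^λ))» as a δ-integral in `A`: constraint `QA = B^{λ₁} + Q∂λ`, gauge condition `A − ∂λ ∈ Ax` ⟺ `A ∈ Ax`
(`sub_gradR_blockConst_mem_Ax_iff`), density `exp(−S(A − ∂λ))` — stated in `eq115_member1`.  Value = kernel certificate
of the printed argument of p. 19 on the carrier of (1.14); NOT summit progress.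
-/

open scoped BigOperators Matrix
open Finset MeasureTheory

namespace Literature.MathematicalPhysics.QuantumFieldTheory.Balaban1983to89.B5Eq115GaugeChain

open B5Prop11Plancherel (Tor fine unitVec)
open B5Block118 (bpt tstep)
open B5Action121 (actionS gaugeT GradOp)
open B5SectBStatements
open B5Eq114Gauss (Z0 Delta1 Wmap rt12_gauss Z0_pos inner_Delta1)

noncomputable section

/-! ## §1  Translation invariance of the δ-integral of linear constraints (the reading (1.40) of «∫dA δ(…)») -/

section Translate

variable {E : Type*} [NormedAddCommGroup E] [InnerProductSpace ℝ E] [FiniteDimensional ℝ E]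
  [MeasurableSpace E] [BorelSpace E]
variable {F : Type*} [AddCommGroup F] [Module ℝ F]

omit [FiniteDimensional ℝ E] [MeasurableSpace E] [BorelSpace E] in
/-- Translating by a gauge-subspace vector `v` moves the fibre over `B` onto the fibre over `B + Cv`: «δ(B + Cv − C(A + v))
δ_G(A + v) = δ(B − CA)δ_G(A)» for `v ∈ G`. [cite: Balaban1984PropagatorsI, (1.40) p.25] -/
theorem add_mem_fibre_add_iff (C : E →ₗ[ℝ] F) (G : Submodule ℝ E) (B : F) {v : E} (hv : v ∈ G) (A : E) :
    A + v ∈ fibre C G (B + C v) ↔ A ∈ fibre C G B := by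
  simp only [mem_fibre_iff, map_add, add_left_inj]
  exact ⟨fun ⟨hC, hG⟩ => ⟨hC, by simpa using G.sub_mem hG hv⟩, fun ⟨hC, hG⟩ => ⟨hC, G.add_mem hG hv⟩⟩

/-- **Translation invariance of the δ-integral** (the change of variables `A → A − v` under «∫dA», `v ∈ G`):
`∫dA δ(B + Cv − CA) δ_G(A) ρ(A − v) = ∫dA δ(B − CA) δ_G(A) ρ(A)` — the flat measure of `N(C) ∩ G` is translation invariant
and the fibre over `B + Cv` is the `v`-translate of the fibre over `B`. [cite: Balaban1984PropagatorsI, (1.40) p.25] -/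
theorem deltaInt_translate (C : E →ₗ[ℝ] F) (G : Submodule ℝ E) (ρ : E → ℝ) (B : F) {v : E} (hv : v ∈ G) :
    deltaInt C G (fun A => ρ (A - v)) (B + C v) = deltaInt C G ρ B := by
  by_cases h : (fibre C G B).Nonempty
  · obtain ⟨A₀, hA₀⟩ := h
    have hA₀' : A₀ + v ∈ fibre C G (B + C v) := (add_mem_fibre_add_iff C G B hv A₀).mpr hA₀
    rw [deltaInt_eq ρ hA₀, deltaInt_eq (fun A => ρ (A - v)) hA₀']
    refine integral_congr_ae (ae_of_all _ fun w => ?_)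
    show ρ (A₀ + v + (w : E) - v) = ρ (A₀ + (w : E))
    congr 1
    abel
  · have h' : ¬ (fibre C G (B + C v)).Nonempty := fun ⟨A, hA⟩ =>
      h ⟨A - v, (add_mem_fibre_add_iff C G B hv (A - v)).mp (by simpa using hA)⟩
    rw [deltaInt_of_isEmpty _ h, deltaInt_of_isEmpty _ h']

end Translate

/-! ## §2  Gauge transformations of real fields («A^λ = A − ∂λ» on `T₁`, «B^{λ₁}» (1.9) on `T_L^{(1)}`, the block-constant
extension) and the printed reasons «S(A^λ) = S(A)», (1.13) «QA^λ = QA − ∂Q′λ», «Q′λ = λ₁», «δ_Ax(A^λ) = δ_Ax(A)» -/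

section Gauge

variable {d : ℕ}

/-- «(∂λ)» at unit lattice factor, `(∂λ)_ν(x) = λ(x + e_ν) − λ(x)`, as a real vector field (the gauge transformation
(1.4) on the unit lattice `T₁` is «A^λ = A − ∂λ»). [cite: Balaban1984PropagatorsI, (1.4) p.18] -/
def gradR {N : Fin d → ℕ} (l : Scl N) : Fld N :=
  WithLp.toLp 2 fun i => l (i.1 + unitVec N i.2) - l i.1

/-- the value of «(∂λ)» on the bond `⟨x, x + e_ν⟩`. [cite: Balaban1984PropagatorsI, (1.4) p.18] -/
theorem gradR_apply {N : Fin d → ℕ} (l : Scl N) (x : Tor N) (ν : Fin d) :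
    gradR l (x, ν) = l (x + unitVec N ν) - l x := rfl

/-- DICTIONARY: «∂λ» IS the tree's `B5Action121.GradOp N 1` on the complexified function. [cite: Balaban1984PropagatorsI, (1.4) p.18] -/
theorem cplx_gradR {N : Fin d → ℕ} [∀ μ, NeZero (N μ)] (l : Scl N) :
    cplx (gradR l) = GradOp N 1 *ᵥ cplxS l := by
  funext i
  obtain ⟨x, ν⟩ := i
  simp only [cplx, cplxS, gradR_apply, B5Action121.GradOp_mulVec, B5Action121.sdiff_mulVec, one_mul]
  push_cast
  ring

/-- complexification is additive: `(A − A′)^ℂ = A^ℂ − A′^ℂ`. [cite: Balaban1984PropagatorsI, (1.1) p.18] -/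
theorem cplx_sub {N : Fin d → ℕ} (A A' : Fld N) : cplx (A - A') = cplx A - cplx A' := by
  funext i
  simp only [cplx, PiLp.sub_apply, Complex.ofReal_sub, Pi.sub_apply]

/-- DICTIONARY: «A^λ = A − ∂λ» of a real field IS the tree's `B5Action121.gaugeT N 1` ((1.4) at lattice factor `1`) on the
complexified field. [cite: Balaban1984PropagatorsI, (1.4) p.18] -/
theorem cplx_sub_gradR {N : Fin d → ℕ} [∀ μ, NeZero (N μ)] (A : Fld N) (l : Scl N) :
    cplx (A - gradR l) = gaugeT N 1 (cplx A) (cplxS l) := by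
  rw [cplx_sub, cplx_gradR]
  rfl

/-- **«S(A^λ) = S(A)»**: the unit-lattice action (1.5) is gauge invariant («The covariant derivative ∂A, and so the
action above, are invariant …», p. 18; tree `B5Action121.actionS_gaugeT`). [cite: Balaban1984PropagatorsI, (1.5) p.18] -/
theorem action1_sub_gradR {N : Fin d → ℕ} [∀ μ, NeZero (N μ)] (A : Fld N) (l : Scl N) :
    action1 (A - gradR l) = action1 A := by
  unfold action1
  rw [cplx_sub_gradR, B5Action121.actionS_gaugeT]

/-- telescoping along a line of `m` bonds (real-valued twin of `B5Block118.sum_fin_telescope`).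
[cite: Balaban1984PropagatorsI, (1.13) p.19] -/
theorem sum_fin_telescope_real (g : ℕ → ℝ) (m : ℕ) :
    ∑ t : Fin m, (g ((t : ℕ) + 1) - g t) = g m - g 0 := by
  rw [Fin.sum_univ_eq_sum_range (fun t => g (t + 1) - g t) m, Finset.sum_range_sub]

/-- `1·e_μ = e_μ`. [cite: Balaban1984PropagatorsI, (1.7) p.18] -/
theorem tstep_one {N : Fin d → ℕ} (μ : Fin d) : tstep N μ 1 = unitVec N μ := by
  show tstep N μ (0 + 1) = unitVec N μ
  rw [B5Block118.tstep_succ, B5Block118.tstep_zero, zero_add]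

variable (n : ℕ) (M : Fin d → ℕ)

/-- **«Q(∂λ) = ∂Q′λ» with the L-lattice gradient** — the content of (1.13): averaging the pure gauge `∂λ` over the
straight contours `[x, x(c)]` of (1.11) telescopes to `L^{−1}((Q′λ)(c₊) − (Q′λ)(c₋))` (`L^{−1} = n^{−(d+1)}·n^d`); real-field
reading of the row-`B5.Eq1.13` decl `B5Block118.QvOp_gaugeT`. [cite: Balaban1984PropagatorsI, (1.13) p.19] -/
theorem Qlin_gradR (l : Scl (fine n M)) :
    Qlin n M (gradR l) = (n : ℝ)⁻¹ • gradR (QsLin n M l) := by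
  ext b
  obtain ⟨y, μ⟩ := b
  rw [Qlin_apply, PiLp.smul_apply, gradR_apply, QsLin_apply, QsLin_apply, smul_eq_mul]
  simp only [qFun, qsFun, gradR_apply]
  have key : ∀ j : Fin d → Fin n,
      ∑ t : Fin n, (l (bpt n M y j + tstep (fine n M) μ t + unitVec (fine n M) μ)
          - l (bpt n M y j + tstep (fine n M) μ t))
        = l (bpt n M (y + unitVec M μ) j) - l (bpt n M y j) := by
    intro j
    have h := sum_fin_telescope_real (fun t => l (bpt n M y j + tstep (fine n M) μ t)) n
    simp only [B5Block118.tstep_succ, ← add_assoc, B5Block118.tstep_zero, add_zero] at h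
    rw [B5Block118.bpt_add_tstep] at h
    exact h
  rw [Finset.sum_congr rfl fun j _ => key j, Finset.sum_sub_distrib]
  ring

/-- **(1.13)/(1.9) on real fields**: «B^λ_c = B_c − L^{−1}((Q′λ)(c₊) − (Q′λ)(c₋)) = B_c − (∂Q′λ)(c)» for `B = QA`, i.e.
`Q(A − ∂λ) = QA − L^{−1}∂(Q′λ)`. [cite: Balaban1984PropagatorsI, (1.13) p.19] -/
theorem Qlin_sub_gradR (A : Fld (fine n M)) (l : Scl (fine n M)) :
    Qlin n M (A - gradR l) = Qlin n M A - (n : ℝ)⁻¹ • gradR (QsLin n M l) := by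
  rw [map_sub, Qlin_gradR]

/-- p. 20, verbatim: *"The δ-function δ(B − Q_kA) is invariant with respect to gauge transformations λ satisfying
Q′_kλ = 0"* — at one level: `Q′λ = 0 ⇒ Q(A − ∂λ) = QA`. [cite: Balaban1984PropagatorsI, (1.20) p.20] -/
theorem Qlin_sub_gradR_of_QsLin_eq_zero (A : Fld (fine n M)) (l : Scl (fine n M)) (hl : QsLin n M l = 0) :
    Qlin n M (A - gradR l) = Qlin n M A := by
  rw [Qlin_sub_gradR, hl]
  have h0 : gradR (0 : Scl M) = 0 := by
    ext ⟨x, ν⟩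
    simp [gradR_apply]
  rw [h0, smul_zero, sub_zero]

variable [NeZero n] [hM : ∀ μ, NeZero (M μ)]

/-- **«defining λ on T₁ as constant on each block, λ(x) = λ₁(y) for x∈B(y)»**: the block-constant extension of a gauge
function `λ₁` of the block lattice `T_L^{(1)}` to the fine lattice `T₁`. [cite: Balaban1984PropagatorsI, (1.15) p.19] -/
def blockConst (l₁ : Scl M) : Scl (fine n M) :=
  WithLp.toLp 2 fun x => l₁ (B5Blocks16.blockOf n M x)

/-- «λ(x) = λ₁(y) for x∈B(y)», `y = blockOf x`. [cite: Balaban1984PropagatorsI, (1.15) p.19] -/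
theorem blockConst_apply (l₁ : Scl M) (x : Tor (fine n M)) :
    blockConst n M l₁ x = l₁ (B5Blocks16.blockOf n M x) := rfl

/-- «λ(x) = λ₁(y) for x∈B(y)», `x = ny + j`. [cite: Balaban1984PropagatorsI, (1.15) p.19] -/
theorem blockConst_bpt (l₁ : Scl M) (y : Tor M) (j : Fin d → Fin n) :
    blockConst n M l₁ (bpt n M y j) = l₁ y := by
  rw [blockConst_apply, B5Blocks16.blockOf_bpt]

/-- **«Q′λ = λ₁»** for the block-constant extension: the block average (1.13) of a function constant on blocks is that
function (`n^{−d}·n^d = 1`; complex twin: `B5Blocks16.QsOp_blockConst`). [cite: Balaban1984PropagatorsI, (1.13) p.19] -/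
theorem QsLin_blockConst (l₁ : Scl M) : QsLin n M (blockConst n M l₁) = l₁ := by
  have hn : (n : ℝ) ≠ 0 := by exact_mod_cast NeZero.ne n
  ext y
  rw [QsLin_apply]
  simp only [qsFun]
  rw [Finset.sum_congr rfl fun j _ => blockConst_bpt n M l₁ y j]
  simp only [Finset.sum_const, Finset.card_univ, Fintype.card_pi, Fintype.card_fin, Finset.prod_const, nsmul_eq_mul]
  push_cast
  field_simp

/-- a bond `⟨p, p + e_ν⟩` of the contour `Γ_{y,x}` of (1.7) ENDS inside the block `B(y)` (its step counter `t < j_ν ≤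
n − 1` stays below `n − 1`). [cite: Balaban1984PropagatorsI, (1.7) p.18] -/
theorem blockOf_stair_succ (y : Tor M) (j : Fin d → Fin n) (ν : Fin d) (t : Fin n) (ht : (t : ℕ) < (j ν : ℕ)) :
    B5Blocks16.blockOf n M (bpt n M y (stairPt n j ν t) + unitVec (fine n M) ν) = y := by
  have h : ((stairPt n j ν t) ν : ℕ) + 1 < n := by
    rw [stairPt_self]
    have := (j ν).is_lt
    omega
  rw [← tstep_one, Beta.FluctuationProjection.bpt_add_tstep_of_lt n M y _ ν 1 h, B5Blocks16.blockOf_bpt]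

/-- **«δ_Ax(A^λ) = δ_Ax(A)», termwise**: for the block-constant `λ` every bond of a contour `Γ_{y,x}`, `x ∈ B(y)`, has
both end-points in `B(y)`, so `(∂λ)(Γ_{y,x}) = Σ (λ₁(y) − λ₁(y)) = 0`. [cite: Balaban1984PropagatorsI, (1.10) p.19] -/
theorem axSum_gradR_blockConst (l₁ : Scl M) (y : Tor M) (j : Fin d → Fin n) :
    axSum n M (gradR (blockConst n M l₁)) y j = 0 := by
  unfold axSum
  refine Finset.sum_eq_zero fun ν _ => Finset.sum_eq_zero fun t _ => ?_
  by_cases ht : (t : ℕ) < (j ν : ℕ)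
  · have h1 : gradR (blockConst n M l₁) (bpt n M y (stairPt n j ν t), ν) = 0 := by
      rw [gradR_apply, blockConst_apply, blockConst_apply, blockOf_stair_succ n M y j ν t ht,
        B5Blocks16.blockOf_bpt, sub_self]
    rw [h1, mul_zero]
  · rw [if_neg ht, zero_mul]

/-- hence the pure gauge `∂λ` of a block-constant `λ` is itself axial (1.10). [cite: Balaban1984PropagatorsI, (1.10) p.19] -/
theorem gradR_blockConst_mem_Ax (l₁ : Scl M) : gradR (blockConst n M l₁) ∈ Ax n M :=
  (mem_Ax_iff n M _).mpr fun y j => axSum_gradR_blockConst n M l₁ y j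

/-- **«δ_Ax(A^λ) = δ_Ax(A)»**: for the block-constant `λ`, `A^λ = A − ∂λ` satisfies the axial gauge conditions (1.10) iff
`A` does. [cite: Balaban1984PropagatorsI, (1.10) p.19] -/
theorem sub_gradR_blockConst_mem_Ax_iff (A : Fld (fine n M)) (l₁ : Scl M) :
    A - gradR (blockConst n M l₁) ∈ Ax n M ↔ A ∈ Ax n M := by
  have h := gradR_blockConst_mem_Ax n M l₁
  exact ⟨fun hA => by simpa using (Ax n M).add_mem hA h, fun hA => (Ax n M).sub_mem hA h⟩

/-- **(1.9) `B^{λ₁}`**: «B^λ_c = B_c − L^{−1}(λ(c₊) − λ(c₋)) = B_c − (∂λ)(c)» — the gauge transformation of a block field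
by a gauge function `λ₁` of `T_L^{(1)}` (spacing `L` = `n`, hence `L^{−1}`). [cite: Balaban1984PropagatorsI, (1.9) p.19] -/
def gaugeC (B : Fld M) (l₁ : Scl M) : Fld M :=
  B - (n : ℝ)⁻¹ • gradR l₁

omit [NeZero n] hM in
/-- (1.9) componentwise: `B^{λ₁}_c = B_c − L^{−1}(λ₁(c₊) − λ₁(c₋))`, `c = ⟨y, y + Le_μ⟩ ↔ (y, μ)`.
[cite: Balaban1984PropagatorsI, (1.9) p.19] -/
theorem gaugeC_apply (B : Fld M) (l₁ : Scl M) (y : Tor M) (μ : Fin d) :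
    gaugeC n M B l₁ (y, μ) = B (y, μ) - (n : ℝ)⁻¹ * (l₁ (y + unitVec M μ) - l₁ y) := by
  simp only [gaugeC, PiLp.sub_apply, PiLp.smul_apply, gradR_apply, smul_eq_mul]

omit [NeZero n] in
/-- DICTIONARY: `B^{λ₁}` of (1.9) IS the tree's `B5Action121.gaugeT M L⁻¹` ((1.4) at lattice factor `L^{−1}`) on the
complexified block field. [cite: Balaban1984PropagatorsI, (1.9) p.19] -/
theorem cplx_gaugeC (B : Fld M) (l₁ : Scl M) :
    cplx (gaugeC n M B l₁) = gaugeT M ((n : ℂ)⁻¹) (cplx B) (cplxS l₁) := by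
  funext i
  obtain ⟨y, μ⟩ := i
  simp only [cplx, cplxS, gaugeC_apply, gaugeT, Pi.sub_apply, B5Action121.GradOp_mulVec, B5Action121.sdiff_mulVec]
  push_cast
  ring

/-- (1.13) for the block-constant extension: **`Q(A − ∂λ) = B^{λ₁}`** for `B = QA` («B^{λ₁} − QA^λ = B − ∂λ₁ − QA +
∂Q′λ» with «Q′λ = λ₁»). [cite: Balaban1984PropagatorsI, (1.15) p.19] -/
theorem Qlin_sub_gradR_blockConst (A : Fld (fine n M)) (l₁ : Scl M) :
    Qlin n M (A - gradR (blockConst n M l₁)) = gaugeC n M (Qlin n M A) l₁ := by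
  rw [Qlin_sub_gradR, QsLin_blockConst]
  rfl

end Gauge

/-! ## §3  (1.15): the chain of integral identities and the gauge invariance of `⟨B, Δ₁B⟩` -/

section Chain

variable {d : ℕ} (n : ℕ) [NeZero n] (M : Fin d → ℕ) [hM : ∀ μ, NeZero (M μ)]

/-- **(1.15), first equality** (any density `ρ`): the change of variables «A → A^λ = A − ∂λ» under «∫dA» —
`(Tρ)(B^{λ₁}) = ∫dA δ(B^{λ₁} − QA^λ)δ_Ax(A^λ)ρ(A^λ)`.  READING of the right member as a δ-integral in the variable `A`:
constraint `Q(A − ∂λ) = B^{λ₁}` ⟺ `QA = B^{λ₁} + Q∂λ`; gauge condition `A − ∂λ ∈ Ax` ⟺ `A ∈ Ax`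
(`sub_gradR_blockConst_mem_Ax_iff`); density `ρ(A − ∂λ)`. [cite: Balaban1984PropagatorsI, (1.15) p.19] -/
theorem eq115_member1 (ρ : Fld (fine n M) → ℝ) (B : Fld M) (l₁ : Scl M) :
    rtT n M ρ (gaugeC n M B l₁)
      = deltaInt (Qlin n M) (Ax n M) (fun A => ρ (A - gradR (blockConst n M l₁)))
          (gaugeC n M B l₁ + Qlin n M (gradR (blockConst n M l₁))) :=
  (deltaInt_translate (Qlin n M) (Ax n M) ρ (gaugeC n M B l₁) (gradR_blockConst_mem_Ax n M l₁)).symm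

/-- **(1.15), second equality** (for a density invariant under the block-constant gauge transformation, e.g. `e^{−S}`):
«∫dA δ(B^{λ₁} − QA^λ)δ_Ax(A^λ)ρ(A^λ) = ∫dA δ(B − ∂λ₁ − QA + ∂Q′λ)δ_Ax(A)ρ(A)» — by `ρ(A^λ) = ρ(A)`, «δ_Ax(A^λ) =
δ_Ax(A)» and (1.13) «QA^λ = QA − ∂Q′λ» (`Qlin_gradR`; `∂ = L^{−1}·gradR`). [cite: Balaban1984PropagatorsI, (1.15) p.19] -/
theorem eq115_member2 (ρ : Fld (fine n M) → ℝ) (B : Fld M) (l₁ : Scl M)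
    (hρ : ∀ A : Fld (fine n M), ρ (A - gradR (blockConst n M l₁)) = ρ A) :
    deltaInt (Qlin n M) (Ax n M) (fun A => ρ (A - gradR (blockConst n M l₁)))
        (gaugeC n M B l₁ + Qlin n M (gradR (blockConst n M l₁)))
      = deltaInt (Qlin n M) (Ax n M) ρ
        (B - (n : ℝ)⁻¹ • gradR l₁ + (n : ℝ)⁻¹ • gradR (QsLin n M (blockConst n M l₁))) := by
  have h1 : (fun A : Fld (fine n M) => ρ (A - gradR (blockConst n M l₁))) = ρ := funext hρ
  rw [h1, Qlin_gradR]
  rfl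

/-- **(1.15), third equality** (for any density): «∫dA δ(B − ∂λ₁ − QA + ∂Q′λ)δ_Ax(A)ρ(A) = (Tρ)(B)» — by «Q′λ = λ₁»
the constraint is `QA = B`. [cite: Balaban1984PropagatorsI, (1.15) p.19] -/
theorem eq115_member3 (ρ : Fld (fine n M) → ℝ) (B : Fld M) (l₁ : Scl M) :
    deltaInt (Qlin n M) (Ax n M) ρ
        (B - (n : ℝ)⁻¹ • gradR l₁ + (n : ℝ)⁻¹ • gradR (QsLin n M (blockConst n M l₁)))
      = rtT n M ρ B := by
  rw [QsLin_blockConst, sub_add_cancel]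
  rfl

/-- **The renormalization transformation (1.12) is gauge covariant**: `(Tρ)(B^{λ₁}) = (Tρ)(B)` for every density `ρ`
invariant under the block-constant gauge transformations — (1.15) composed. [cite: Balaban1984PropagatorsI, (1.15) p.19] -/
theorem rtT_gaugeC (ρ : Fld (fine n M) → ℝ) (B : Fld M) (l₁ : Scl M)
    (hρ : ∀ A : Fld (fine n M), ρ (A - gradR (blockConst n M l₁)) = ρ A) :
    rtT n M ρ (gaugeC n M B l₁) = rtT n M ρ B := by
  rw [eq115_member1, eq115_member2 n M ρ B l₁ hρ, eq115_member3]

/-- **(1.15) for `(Te^{−S})`**: `(Te^{−S})(B^{λ₁}) = (Te^{−S})(B)` for every `B` and every gauge function `λ₁` of `T_L^{(1)}`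
(every `d`, `n ≥ 1`, torus; no hypothesis) — «S(A^λ) = S(A)». [cite: Balaban1984PropagatorsI, (1.15) p.19] -/
theorem rt12_gaugeC (B : Fld M) (l₁ : Scl M) : rt12 n M (gaugeC n M B l₁) = rt12 n M B := by
  show rtT n M (fun A => Real.exp (-action1 A)) (gaugeC n M B l₁) = rtT n M (fun A => Real.exp (-action1 A)) B
  exact rtT_gaugeC n M _ B l₁ fun A => congrArg (fun x => Real.exp (-x)) (action1_sub_gradR A (blockConst n M l₁))

/-- **(1.15) VERBATIM, the displayed chain** «Z^{(0)}exp(−½⟨B^{λ₁}, Δ₁B^{λ₁}⟩) = ∫dA δ(B^{λ₁} − QA^λ)δ_Ax(A^λ)exp(−S(A^λ))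
= ∫dA δ(B − ∂λ₁ − QA + ∂Q′λ)δ_Ax(A)exp(−S(A)) = Z^{(0)}exp(−½⟨B, Δ₁B⟩)» for the `Z^{(0)}`, `Δ₁` of (1.14) (`B5Eq114Gauss.Z0/
Delta1`, via `rt12_gauss`): the three equalities as a conjunction. [cite: Balaban1984PropagatorsI, (1.15) p.19] -/
theorem eq115_chain (B : Fld M) (l₁ : Scl M) :
    Z0 n M * Real.exp (-S1 M (Delta1 n M) (gaugeC n M B l₁))
        = deltaInt (Qlin n M) (Ax n M) (fun A => Real.exp (-action1 (A - gradR (blockConst n M l₁))))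
            (gaugeC n M B l₁ + Qlin n M (gradR (blockConst n M l₁)))
      ∧ deltaInt (Qlin n M) (Ax n M) (fun A => Real.exp (-action1 (A - gradR (blockConst n M l₁))))
            (gaugeC n M B l₁ + Qlin n M (gradR (blockConst n M l₁)))
          = deltaInt (Qlin n M) (Ax n M) (fun A => Real.exp (-action1 A))
            (B - (n : ℝ)⁻¹ • gradR l₁ + (n : ℝ)⁻¹ • gradR (QsLin n M (blockConst n M l₁)))
      ∧ deltaInt (Qlin n M) (Ax n M) (fun A => Real.exp (-action1 A))
            (B - (n : ℝ)⁻¹ • gradR l₁ + (n : ℝ)⁻¹ • gradR (QsLin n M (blockConst n M l₁)))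
          = Z0 n M * Real.exp (-S1 M (Delta1 n M) B) := by
  refine ⟨?_, eq115_member2 n M (fun A => Real.exp (-action1 A)) B l₁
    fun A => congrArg (fun x => Real.exp (-x)) (action1_sub_gradR A (blockConst n M l₁)), ?_⟩
  · rw [← rt12_gauss]
    exact eq115_member1 n M (fun A => Real.exp (-action1 A)) B l₁
  · rw [← rt12_gauss]
    exact eq115_member3 n M (fun A => Real.exp (-action1 A)) B l₁

/-- **(1.15), the printed conclusion: *"The form ⟨B, Δ₁B⟩ is gauge invariant"*** — `⟨B^{λ₁}, Δ₁B^{λ₁}⟩ = ⟨B, Δ₁B⟩` for the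
operator `Δ₁` DEFINED by (1.14) (`B5Eq114Gauss.Delta1`), every `B`, every gauge function `λ₁` of `T_L^{(1)}`; `d ≥ 2` as in
`B5Eq114Gauss.Z0_pos` (`Z^{(0)} > 0` lets the extreme members determine the form). [cite: Balaban1984PropagatorsI, (1.15) p.19] -/
theorem eq115_Delta1 (hd : 2 ≤ d) (B : Fld M) (l₁ : Scl M) :
    inner ℝ (gaugeC n M B l₁) (Delta1 n M (gaugeC n M B l₁)) = inner ℝ B (Delta1 n M B) := by
  have hZ : Z0 n M ≠ 0 := (Z0_pos n M hd).ne'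
  have h := rt12_gaugeC n M B l₁
  rw [rt12_gauss, rt12_gauss] at h
  have h2 := Real.exp_injective (mul_left_cancel₀ hZ h)
  simp only [S1, neg_inj] at h2
  linarith

/-- **Operator form of (1.15): `Δ₁(∂λ₁) = 0`** — by (1.15) at `B = L^{−1}∂λ₁` (so `B^{λ₁} = 0`), `0 = ⟨B, Δ₁B⟩ = ‖WB‖²`
(`B5Eq114Gauss.inner_Delta1`), hence `WB = 0` and `Δ₁B = W†WB = 0`. [cite: Balaban1984PropagatorsI, (1.15) p.19] -/
theorem Delta1_gradR (hd : 2 ≤ d) (l₁ : Scl M) : Delta1 n M (gradR l₁) = 0 := by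
  have hn : ((n : ℝ)⁻¹) ≠ 0 := inv_ne_zero (by exact_mod_cast NeZero.ne n)
  have h := eq115_Delta1 n M hd ((n : ℝ)⁻¹ • gradR l₁) l₁
  have h0 : gaugeC n M ((n : ℝ)⁻¹ • gradR l₁) l₁ = 0 := sub_self _
  rw [h0, map_zero, inner_zero_right, inner_Delta1] at h
  have hW : Wmap n M ((n : ℝ)⁻¹ • gradR l₁) = 0 := by
    have h3 : ‖Wmap n M ((n : ℝ)⁻¹ • gradR l₁)‖ ^ 2 = 0 := h.symm
    exact norm_eq_zero.mp (pow_eq_zero_iff two_ne_zero |>.mp h3)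
  rw [map_smul, smul_eq_zero] at hW
  have hW' : Wmap n M (gradR l₁) = 0 := hW.resolve_left hn
  show (LinearMap.adjoint (Wmap n M) ∘ₗ Wmap n M) (gradR l₁) = 0
  rw [LinearMap.comp_apply, hW', map_zero]

/-- hence **`Δ₁B^{λ₁} = Δ₁B`** (Δ₁ is blind to block-lattice gauge transformations) and, once more, (1.15).
[cite: Balaban1984PropagatorsI, (1.15) p.19] -/
theorem Delta1_gaugeC (hd : 2 ≤ d) (B : Fld M) (l₁ : Scl M) :
    Delta1 n M (gaugeC n M B l₁) = Delta1 n M B := by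
  rw [gaugeC, map_sub, map_smul, Delta1_gradR n M hd, smul_zero, sub_zero]

end Chain

end
end Literature.MathematicalPhysics.QuantumFieldTheory.Balaban1983to89.B5Eq115GaugeChain
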